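import Summits.QuantumFields.YangMills.Theorems.BalabanUVNodesN22W1RelCentredDatumKnitLG
import Summits.QuantumFields.YangMills.Theorems.BalabanUVNodesN22W1RelCentredSliceInputsLGOfU

/-!
# BalabanUVNodes ∕ node N22 = NE9 — THE RELATIVE-DISC CENTRED ROAD OVER THE ADMISSIBLE CLASS, MODULE J12-K: THE KNIT AT THE DATUM OVER UNIFORM ∕ PRIMITIVE LOCATED INPUTS —
# `N22At` at the admissible reading of record on the run towers generated by the (2.14) term datum FROM ONE `SliceInputsLGU` RECORD PER SLICE AND TABLE on an open thickening of the
# table, i.e. from located inputs NONE of which is an integral-level analyticity statement (module J10c's knit VERBATIM, its binder `ι` fed by J12-M ∘ J11)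

Cell `pub-ymgap`, HUMAN RULING D-0062 (Track A), R134 ACCELERATION re-seat `pub-ymgap-dag-n22-c` (strategy s1), generation 9, file J12-K.  THEOREMS ONLY; imports J10c `…DatumKnitLG` (the
knit) and J12-M `…SliceInputsLGOfU` (every configuration of the thickening gets the J10-D record; through it J12-D and J11) BY NAME.  `--supports` K3⁷ `SpineGivenEndpointR13SepCoPH`
(stmt-QuantumFields-20544) as a helper.

WHY ∕ WHAT.  J10c's knit asks, per slice AND PER CONFIGURATION `φ` of the table `U^c_{k′+1}(X, α₀, α₁)`, one J10-D record `SliceInputsLG … φ …` whose fields `hMan` ∕ `hVan` — the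
window-dilated member and the coupling-blind centre ANALYTIC IN THE CONFIGURATION at `φ` — are integral-level statements ([II] p. 15 ll. 19–20, a TYPE in print).  Module J11 proved both
from print's PRIMITIVE laws on an open thickening; J12-D typed the uniform ∕ primitive record `SliceInputsLGU … W …`; J12-M reads J10-D's record off it at every `φ ∈ W`.  THIS FILE is the
knit over those inputs: J10c's two theorems with `ι` replaced by `ιU : ∀ k′ < k, ∀ X, ∀ Z ⊆ X, ∀ t ∈ terms, ∀ s₀ ∈ window, SliceInputsLGU (𝔇 k′) … (Wt k′ X) …` plus the thickening
`Wt k′ X ⊇ U^c(X)` (`hWsp`); proof = J10c at `ι := choice ∘ J12-M ∘ ιU`.  This is the END of the s1 line at node N22 in PRIMITIVE currency: every remaining located input is NODE A's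
(kernel letters and φ-laws), W1-12's ∕ N10's (local growth letters and φ-laws of the potentials over the admissible class), N09's (the unscaled-field boxes at `s₀` with (2.22), the box
laws), the definers' (the datum, the unscaled-field law `hlaw`, the thickening), node N18's (`N18At` below the run) and the capstone numerics.

HONEST FRAMING — what this is NOT.  Count-neutral by-name knit AT THE OBJECT; NOT a discharge of N22 (typed 28∕28 · discharged 5∕27 UNCHANGED): every located input is a HYPOTHESIS whose
inhabitant at the datum of record is another lane's business; node N18 below is N18's; the datum is DATA; no inhabitant of the record ∕ admissible tuple is claimed (K0 OPEN); vacuous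
where `AdmBg … = ∅`.  A6 (standing rule №189 ∕ №193): the uniform record's type is inhabited at W1-15's degenerate datum with `W := univ` — witness OWED in the sibling file
`…SliceInputsLGUWitness` (J10-W ∕ J10-Wb's construction; both regimes); a JOINT witness with this knit's numerals ∕ `hlaw` ∕ N18-below is NOT claimed.  NE9 NOT IN PRINT for d = 4;
one finite four-torus programme at fixed ε — NOT infinite volume, NOT OS on ℝ⁴, NOT a mass gap, NOT Clay.  0 `sorry`, 0 `def`, standard axioms.

References (TYPES only): [II] = [Balaban1988RG2Cluster] (1.5) p. 3, (1.26) p. 8, (1.34)–(1.36) p. 9, (1.41)–(1.43) p. 11, (2.2)–(2.3) p. 12, (2.9)–(2.15) pp. 14–16, (2.16)–(2.26) pp.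
16–17, Lemma 3 p. 20, (2.39)–(2.41) p. 21; [I] = [Balaban1987RG1] §1 p. 263, (2.9)–(2.13) pp. 266–268; [Chae1985] Thm 14.13.
-/

noncomputable section

open scoped Matrix.Norms.L2Operator

namespace YMDAG.N22.W1

open Set Metric Matrix
open scoped BigOperators
open Literature.MathematicalPhysics.QuantumFieldTheory.Balaban1983to89
open Literature.MathematicalPhysics.QuantumFieldTheory.Balaban1983to89.T4Continuum
open Literature.MathematicalPhysics.QuantumFieldTheory.Balaban1983to89.T4OutputRate
open Literature.MathematicalPhysics.QuantumFieldTheory.Balaban1983to89.TreeLengthTorus (TPt TDom tsys torusTreeLen torusTreeLen_nonneg)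
open Literature.MathematicalPhysics.QuantumFieldTheory.Balaban1983to89.B12TreeDecay (K₀ K₀_pos)
open Literature.MathematicalPhysics.QuantumFieldTheory.Balaban1983to89.B13Lemma3TorusData (TBond)
open Literature.MathematicalPhysics.QuantumFieldTheory.Balaban1983to89.B13Lemma3TorusTerms (terms weight weight_nonneg)
open Literature.MathematicalPhysics.QuantumFieldTheory.Balaban1983to89.B13Lemma3TorusSocket (Lemma3Numerics)
open Literature.MathematicalPhysics.QuantumFieldTheory.Balaban1983to89.B13Term214 (term214 core214 F214)
open Literature.MathematicalPhysics.QuantumFieldTheory.Balaban1983to89.B13Bound143 (invTau)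
open Literature.MathematicalPhysics.QuantumFieldTheory.Balaban1983to89.B9Thm37GlueTorus (tdist1)
open Literature.MathematicalPhysics.QuantumFieldTheory.Balaban1983to89.B5TorusCover (UT)
open Literature.MathematicalPhysics.QuantumFieldTheory.Balaban1983to89.Step (SFConsts)
open Literature.MathematicalPhysics.QuantumFieldTheory.Balaban1983to89.Node00
  (Stage12Params Stage13Params U3Objects₁₁ U3Letters₁₁ NE2Objects₁₁ NE3Letters₁₁ MatA ιSU prependCoupling)
open Literature.MathematicalPhysics.QuantumFieldTheory.Balaban1983to89.Node00.Sect2 (domSys domCount CPair ofBackgroundC spaceI domSites Setting Residual)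
open Literature.MathematicalPhysics.QuantumFieldTheory.Balaban1983to89.Node00.W1
open YMDAG.UVSplit

open Literature.MathematicalPhysics.QuantumFieldTheory.Balaban1983to89.TreeLengthTorus (ineq126_torus tcubeSys)

variable {N : ℕ} [NeZero N]

/-! ## §1 The knit over the uniform ∕ primitive located inputs, θ-free engine -/

section Engine


variable {F : T4Family} {M : ℕ} [NeZero M] {L : ℕ} [NeZero L] (Gn : (k₁ : ℕ) → GenTower (F.P k₁) (MatA N) M)
  (sp : (k j : ℕ) → (domSys (F.P k) M j).Dom → Set (CPair (F.P k) (MatA N)))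
  (gauge : (k : ℕ) → GaugeField (F.P k) 0 (Node00.SU N) → GaugeField (F.P k) 0 (Node00.SU N) → ℝ) (hg : ∀ k U U', 0 ≤ gauge k U U')
  (T₀ : (k : ℕ) → GaugeField (F.P (k + 1)) 0 (Node00.SU N) → GaugeField (F.P k) 0 (Node00.SU N))
  (hT₀ : ∀ (k : ℕ) (U : GaugeField (F.P (k + 1)) 0 (Node00.SU N)),
    (∀ (j : ℕ) (Y : (domSys (F.P (k + 1)) M j).Dom), ofBackgroundC (ιSU N) U ∈ sp (k + 1) j Y) →
    ∀ (j : ℕ) (Y : (domSys (F.P k) M j).Dom), ofBackgroundC (ιSU N) (T₀ k U) ∈ sp k j Y)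
  (li : LetterInputs) (θ : Stage12Params F N) (k : ℕ) (c : B13.Consts) (𝔇 : TermData214 c (F.P k) (MatA N) M L)
  (χu χcu : (k' : ℕ) → (Z : (domSys (F.P k) M (k' + 1)).Dom) → (t : TermLabel (F.P k) M k' L) → (((𝔇 k').𝒦 Z t).Λ → ℝ) → ℝ)
  (𝒲 : (k' : ℕ) → (Z : (domSys (F.P k) M (k' + 1)).Dom) → (t : TermLabel (F.P k) M k' L) → CPair (F.P k) (MatA N) →
    TDom (F.P k).d (L * domCount (F.P k) M (k' + 1)) → (((𝔇 k').𝒦 Z t).Λ → ℝ) → ℂ)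
  (𝒪 : (k' : ℕ) → (Z : (domSys (F.P k) M (k' + 1)).Dom) → (t : TermLabel (F.P k) M k' L) → OlderTerms (F.P k) (MatA N) M k' → CPair (F.P k) (MatA N) →
    TDom (F.P k).d (L * domCount (F.P k) M (k' + 1)) → (((𝔇 k').𝒦 Z t).Λ → ℝ) → ℂ)
  {G : Type*} [GaugeGroup G] (Sg : Setting (MatA N) G) (Rz : Residual (F.P k) (MatA N))


open Classical in
/-- **`N22At` AT THE ADMISSIBLE READING OF RECORD ON THE RUN TOWERS GENERATED BY THE (2.14) DATUM, FROM UNIFORM ∕ PRIMITIVE LOCATED INPUTS UNDER THE UNSCALED-FIELD LAW** — module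
J10c's knit `…_unscaledLawDatumLG` VERBATIM (engine J2ᴬ, readings J5 ∕ J10a ∕ J10b ∕ J7a ∕ J8, the UNSCALED-FIELD LAW of W1-11 by name, node N18 below, the letter signs), its per-slice,
PER-CONFIGURATION located-input binder `ι : ∀ …, ∀ φ ∈ U^c(X), …, SliceInputsLG … φ …` REPLACED by ONE uniform ∕ primitive record per slice and table `X`, `ιU : ∀ …, SliceInputsLGU …
(Wt k′ X) …` (J12-D), on an OPEN thickening `Wt k′ X ⊇ U^c_{k′+1}(X, α₀, α₁)` of the table (print's enlarged constants α′₀, α′₁; dag-n18-c file 11: the table itself is not open in Φ): NO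
located input of this theorem is an integral-level analyticity statement — the member's and the centre's φ-analyticity ([II] p. 15 ll. 19–20) are CONSEQUENCES (J11) of NODE A's kernel
φ-laws, the φ-laws of the Wilson remainder and of the older-terms potential over the admissible class, read into J10-D's record at each configuration by J12-M
`SliceInputsLGU.nonempty_sliceInputsLG_of_uniform` (+ `Classical.choice`).  Conclusion unchanged: `N22At (u3OfRecord₁₂ θ (Dr.u3Objects θ.γ) k)`.  Three-line proof; no estimate proved here.
[cite: Balaban1988RG2Cluster, (1.5) p.3, (1.34)-(1.36) p.9, (1.41) p.11, (2.9)-(2.15) pp.14-16 (p.15 ll.19-20), (2.16)-(2.26) pp.16-17, Lemma 3 p.20 and (2.39)-(2.41) p.21; Balaban1987RG1, §1 p.263, (2.9)-(2.13) pp.266-268; Chae1985, Thm 14.13] -/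
theorem n22At_u3OfRecord₁₂_ofRecordAdm_runTowers_toClusterTower_of_n18Below_unscaledLawDatumLGU {cs : SFConsts} (hGn : Gn k = 𝔇.Gn)
    (hspk : ∀ (j : ℕ) (Y : (domSys (F.P k) M j).Dom), sp k j Y ⊆ spaceI Sg Rz M j (domSites (F.P k) M j Y) cs.α₀ cs.α₁)
    (hrestr : ∀ j : ℕ, SpRestr (M := M) (fun Y : (domSys (F.P k) M (j + 1)).Dom => spaceI Sg Rz M (j + 1) (domSites (F.P k) M (j + 1) Y) cs.α₀ cs.α₁))
    (hL : 8 ≤ c.L) (hLc : c.L = L) {a a₂ a₂' a₅ a₅' Aabs : ℝ} (hN : Lemma3Numerics c M ((c.L : ℝ) / 2) a a₂ a₂' a₅' Aabs)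
    {E₀ r₁ Mv cA cP ρb : ℝ} (hA0 : 0 ≤ c.C3act * c.ε₁) (hr₁ : 0 ≤ r₁) (hκ : li.κ ≤ r₁)
    (hrate : r₁ + 2 * (64 * Real.log 162) + 2 ≤ (1 - 8 * c.δ) * ((c.L : ℝ) / 2) * c.κ)
    (hsmall : c.C3act * c.ε₁ * Real.exp (5 * r₁ + 1) * K₀ 64 8 * 9 * 64 < 1)
    (hrenew : Real.exp 1 * 9 * 64 * K₀ 64 8 ^ 2 * (c.C3act * c.ε₁) ≤ E₀)
    (h2w : ∀ (k' : ℕ) (Z : (domSys (F.P k) M (k' + 1)).Dom), 2 * Real.exp (a₅ * ((Z.1).card : ℝ)) ≤ Real.exp (a₅' * ((Z.1).card : ℝ)))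
    -- apertures: displayed discs `cA` < producer's sector `cP` < 1, producer's ball radius `ρb`
    (hc0 : 0 < cA) (hcAP : cA < cP) (hcP1 : cP < 1) (hρb : cP / (1 - cP) < ρb)
    (hMv : 0 < Mv) (hMvγ : (1 - cP)⁻¹ ^ 2 * Mv * ((1 + cA) * θ.γ) ^ 2 ≤ 1 / 2) (hAM : 2 * ((1 - cP)⁻¹ ^ 2 * Mv) * E₀ * (1 + cA) ^ 2 ≤ li.A)
    -- THE UNSCALED-FIELD LAW of the datum's last-line data on the real window ([I] (2.9)–(2.12)) — node00-def-W1's W1-11 `TermData214.UnscaledFieldLawOn` BY NAME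
    (hlaw : 𝔇.UnscaledFieldLawOn χu χcu 𝒲 𝒪 θ.γ)
    (hκ₁ : 1 ≤ c.κ₁) (hα₆ : c.α₆ ≠ 0) (hρb1 : ρb < 1)
    -- THE LOCATED INPUTS: ONE UNIFORM ∕ PRIMITIVE record per slice and table `X` (k′ < k, Z ⊆ X, t ∈ terms, s₀ ∈ window) on an OPEN thickening `Wt k′ X ⊇ U^c(X)`
    (Wt : (k' : ℕ) → (domSys (F.P k) M (k' + 1)).Dom → Set (CPair (F.P k) (MatA N)))
    (hWsp : ∀ (k' : ℕ) (X : (domSys (F.P k) M (k' + 1)).Dom), spaceI Sg Rz M (k' + 1) (domSites (F.P k) M (k' + 1) X) cs.α₀ cs.α₁ ⊆ Wt k' X)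
    (ιU : ∀ k' : ℕ, k' < k → ∀ (X Z : (domSys (F.P k) M (k' + 1)).Dom), Z.1 ⊆ X.1 → ∀ t ∈ terms L M Z, ∀ s₀ ∈ Ioc (0 : ℝ) θ.γ,
      SliceInputsLGU (𝔇 k') (χu k') (χcu k') (𝒲 k') (𝒪 k') c Sg Rz cs E₀ li.κ Z t (Wt k' X) s₀ a a₅ ρb Mv)
    (h18 : ∀ k' : ℕ, k' < k →
      N18At (u3OfRecord₁₂ θ ((ReadingData.ofRecordAdm F M N (runTowers fun k₁ => toClusterTower (Gn k₁)) sp gauge hg T₀ hT₀ li).u3Objects θ.γ) k'))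
    (hC5 : 0 ≤ li.C₅) (hθ1 : li.θ₅ < 1) (hC₀' : 2 * li.C₅ / (1 - li.θ₅) ≤ li.C₀)
    (hC₀ : 0 < li.C₀) (hθ5 : 0 < li.θ₅) (hA : 0 < li.A) (hμ : li.μ = 1) (hr : 0 < li.r) (hrc : li.r ≤ min cA 1) (hγ : 0 < θ.γ) (hs : li.s = (2 : ℝ)⁻¹) :
    N22At (u3OfRecord₁₂ θ ((ReadingData.ofRecordAdm F M N (runTowers fun k₁ => toClusterTower (Gn k₁)) sp gauge hg T₀ hT₀ li).u3Objects θ.γ) k) :=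
  n22At_u3OfRecord₁₂_ofRecordAdm_runTowers_toClusterTower_of_n18Below_unscaledLawDatumLG Gn sp gauge hg T₀ hT₀ li θ k c 𝔇 χu χcu 𝒲 𝒪 Sg Rz hGn hspk
    hrestr hL hLc hN hA0 hr₁ hκ hrate hsmall hrenew h2w hc0 hcAP hcP1 hρb hMv hMvγ hAM hlaw hκ₁ hα₆ hρb1
    (fun k' hk X _ hφ Z hZ t ht s₀ hs₀ => Classical.choice
      (SliceInputsLGU.nonempty_sliceInputsLG_of_uniform (ιU k' hk X Z hZ t ht s₀ hs₀) hs₀.1 hρb1 (hWsp k' X hφ)))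
    h18 hC5 hθ1 hC₀' hC₀ hθ5 hA hμ hr hrc hγ hs

end Engine

/-! ## §2 The same at one Stage-13 tuple -/

section Engine13


variable {F : T4Family} (θ : Stage13Params F N) {L : ℕ} [NeZero L] (Gn : (k₁ : ℕ) → GenTower (F.P k₁) (MatA N) θ.τ9.M)
  (sp : (k j : ℕ) → (domSys (F.P k) θ.τ9.M j).Dom → Set (CPair (F.P k) (MatA N)))
  (gauge : (k : ℕ) → GaugeField (F.P k) 0 (Node00.SU N) → GaugeField (F.P k) 0 (Node00.SU N) → ℝ) (hg : ∀ k U U', 0 ≤ gauge k U U')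
  (T₀ : (k : ℕ) → GaugeField (F.P (k + 1)) 0 (Node00.SU N) → GaugeField (F.P k) 0 (Node00.SU N))
  (hT₀ : ∀ (k : ℕ) (U : GaugeField (F.P (k + 1)) 0 (Node00.SU N)),
    (∀ (j : ℕ) (Y : (domSys (F.P (k + 1)) θ.τ9.M j).Dom), ofBackgroundC (ιSU N) U ∈ sp (k + 1) j Y) →
    ∀ (j : ℕ) (Y : (domSys (F.P k) θ.τ9.M j).Dom), ofBackgroundC (ιSU N) (T₀ k U) ∈ sp k j Y)
  (li : LetterInputs) (k : ℕ) (c : B13.Consts) (𝔇 : TermData214 c (F.P k) (MatA N) θ.τ9.M L)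
  (χu χcu : (k' : ℕ) → (Z : (domSys (F.P k) θ.τ9.M (k' + 1)).Dom) → (t : TermLabel (F.P k) θ.τ9.M k' L) → (((𝔇 k').𝒦 Z t).Λ → ℝ) → ℝ)
  (𝒲 : (k' : ℕ) → (Z : (domSys (F.P k) θ.τ9.M (k' + 1)).Dom) → (t : TermLabel (F.P k) θ.τ9.M k' L) → CPair (F.P k) (MatA N) →
    TDom (F.P k).d (L * domCount (F.P k) θ.τ9.M (k' + 1)) → (((𝔇 k').𝒦 Z t).Λ → ℝ) → ℂ)
  (𝒪 : (k' : ℕ) → (Z : (domSys (F.P k) θ.τ9.M (k' + 1)).Dom) → (t : TermLabel (F.P k) θ.τ9.M k' L) → OlderTerms (F.P k) (MatA N) θ.τ9.M k' → CPair (F.P k) (MatA N) →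
    TDom (F.P k).d (L * domCount (F.P k) θ.τ9.M (k' + 1)) → (((𝔇 k').𝒦 Z t).Λ → ℝ) → ℂ)
  {G : Type*} [GaugeGroup G] (Sg : Setting (MatA N) G) (Rz : Residual (F.P k) (MatA N))

open Classical in
/-- **THE SAME AT ONE STAGE-13 TUPLE** (`NeZero θ.τ9.M` from the context; the Stage-13 bundle IS the Stage-12 bundle of `θ.toStage12Params`) — the face the keyed binder storeys
instantiate once per tuple, over the uniform ∕ primitive located inputs. [cite: Balaban1988RG2Cluster, (2.9)-(2.15) pp.14-16, Lemma 3 p.20 and (2.39)-(2.41) p.21; Balaban1987RG1, §1 p.263, (2.9)-(2.13) pp.266-268] -/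
theorem n22At_u3OfRecord₁₃_ofRecordAdm_runTowers_toClusterTower_of_n18Below_unscaledLawDatumLGU [NeZero θ.τ9.M] {cs : SFConsts} (hGn : Gn k = 𝔇.Gn)
    (hspk : ∀ (j : ℕ) (Y : (domSys (F.P k) θ.τ9.M j).Dom), sp k j Y ⊆ spaceI Sg Rz θ.τ9.M j (domSites (F.P k) θ.τ9.M j Y) cs.α₀ cs.α₁)
    (hrestr : ∀ j : ℕ, SpRestr (M := θ.τ9.M) (fun Y : (domSys (F.P k) θ.τ9.M (j + 1)).Dom => spaceI Sg Rz θ.τ9.M (j + 1) (domSites (F.P k) θ.τ9.M (j + 1) Y) cs.α₀ cs.α₁))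
    (hL : 8 ≤ c.L) (hLc : c.L = L) {a a₂ a₂' a₅ a₅' Aabs : ℝ} (hN : Lemma3Numerics c θ.τ9.M ((c.L : ℝ) / 2) a a₂ a₂' a₅' Aabs)
    {E₀ r₁ Mv cA cP ρb : ℝ} (hA0 : 0 ≤ c.C3act * c.ε₁) (hr₁ : 0 ≤ r₁) (hκ : li.κ ≤ r₁)
    (hrate : r₁ + 2 * (64 * Real.log 162) + 2 ≤ (1 - 8 * c.δ) * ((c.L : ℝ) / 2) * c.κ)
    (hsmall : c.C3act * c.ε₁ * Real.exp (5 * r₁ + 1) * K₀ 64 8 * 9 * 64 < 1)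
    (hrenew : Real.exp 1 * 9 * 64 * K₀ 64 8 ^ 2 * (c.C3act * c.ε₁) ≤ E₀)
    (h2w : ∀ (k' : ℕ) (Z : (domSys (F.P k) θ.τ9.M (k' + 1)).Dom), 2 * Real.exp (a₅ * ((Z.1).card : ℝ)) ≤ Real.exp (a₅' * ((Z.1).card : ℝ)))
    -- apertures: displayed discs `cA` < producer's sector `cP` < 1, producer's ball radius `ρb`
    (hc0 : 0 < cA) (hcAP : cA < cP) (hcP1 : cP < 1) (hρb : cP / (1 - cP) < ρb)
    (hMv : 0 < Mv) (hMvγ : (1 - cP)⁻¹ ^ 2 * Mv * ((1 + cA) * θ.γ) ^ 2 ≤ 1 / 2) (hAM : 2 * ((1 - cP)⁻¹ ^ 2 * Mv) * E₀ * (1 + cA) ^ 2 ≤ li.A)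
    -- THE UNSCALED-FIELD LAW of the datum's last-line data on the real window ([I] (2.9)–(2.12)) — node00-def-W1's W1-11 `TermData214.UnscaledFieldLawOn` BY NAME
    (hlaw : 𝔇.UnscaledFieldLawOn χu χcu 𝒲 𝒪 θ.γ)
    (hκ₁ : 1 ≤ c.κ₁) (hα₆ : c.α₆ ≠ 0) (hρb1 : ρb < 1)
    -- THE LOCATED INPUTS: ONE UNIFORM ∕ PRIMITIVE record per slice and table `X` (k′ < k, Z ⊆ X, t ∈ terms, s₀ ∈ window) on an OPEN thickening `Wt k′ X ⊇ U^c(X)`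
    (Wt : (k' : ℕ) → (domSys (F.P k) θ.τ9.M (k' + 1)).Dom → Set (CPair (F.P k) (MatA N)))
    (hWsp : ∀ (k' : ℕ) (X : (domSys (F.P k) θ.τ9.M (k' + 1)).Dom), spaceI Sg Rz θ.τ9.M (k' + 1) (domSites (F.P k) θ.τ9.M (k' + 1) X) cs.α₀ cs.α₁ ⊆ Wt k' X)
    (ιU : ∀ k' : ℕ, k' < k → ∀ (X Z : (domSys (F.P k) θ.τ9.M (k' + 1)).Dom), Z.1 ⊆ X.1 → ∀ t ∈ terms L θ.τ9.M Z, ∀ s₀ ∈ Ioc (0 : ℝ) θ.γ,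
      SliceInputsLGU (𝔇 k') (χu k') (χcu k') (𝒲 k') (𝒪 k') c Sg Rz cs E₀ li.κ Z t (Wt k' X) s₀ a a₅ ρb Mv)
    (h18 : ∀ k' : ℕ, k' < k →
      N18At (u3OfRecord₁₃ θ ((ReadingData.ofRecordAdm F θ.τ9.M N (runTowers fun k₁ => toClusterTower (Gn k₁)) sp gauge hg T₀ hT₀ li).u3Objects θ.γ) k'))
    (hC5 : 0 ≤ li.C₅) (hθ1 : li.θ₅ < 1) (hC₀' : 2 * li.C₅ / (1 - li.θ₅) ≤ li.C₀)
    (hC₀ : 0 < li.C₀) (hθ5 : 0 < li.θ₅) (hA : 0 < li.A) (hμ : li.μ = 1) (hr : 0 < li.r) (hrc : li.r ≤ min cA 1) (hγ : 0 < θ.γ) (hs : li.s = (2 : ℝ)⁻¹) :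
    N22At (u3OfRecord₁₃ θ ((ReadingData.ofRecordAdm F θ.τ9.M N (runTowers fun k₁ => toClusterTower (Gn k₁)) sp gauge hg T₀ hT₀ li).u3Objects θ.γ) k) :=
  n22At_u3OfRecord₁₃_ofRecordAdm_runTowers_toClusterTower_of_n18Below_unscaledLawDatumLG θ Gn sp gauge hg T₀ hT₀ li k c 𝔇 χu χcu 𝒲 𝒪 Sg Rz hGn hspk
    hrestr hL hLc hN hA0 hr₁ hκ hrate hsmall hrenew h2w hc0 hcAP hcP1 hρb hMv hMvγ hAM hlaw hκ₁ hα₆ hρb1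
    (fun k' hk X _ hφ Z hZ t ht s₀ hs₀ => Classical.choice
      (SliceInputsLGU.nonempty_sliceInputsLG_of_uniform (ιU k' hk X Z hZ t ht s₀ hs₀) hs₀.1 hρb1 (hWsp k' X hφ)))
    h18 hC5 hθ1 hC₀' hC₀ hθ5 hA hμ hr hrc hγ hs

end Engine13

end YMDAG.N22.W1

end
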